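import Mathlib

/-!
# Tier4/Common/HaarProductSetIntegral — the SET integral over a product domain with a free first coordinate,
`e.symm '' (univ ×ˢ S)`, against `μ = c • (e.symm)_*(ν₁ ⊗ ν₂)`, is `c` times the iterated integral with the inner integral
restricted to `S`

Blind re-derivation cell `pub-hodge-repro`, Tier 4 (README §9–§10), seat t4-typer-1 (gen 2).  Target tree path
`lean/Summits/Ventures/HodgeRepro/Tier4/Common/HaarProductSetIntegral.lean`.  Imports Mathlib only; companion of
`HaarProductTransport` (p694668: the full-space version (7)), `HaarProductIntegralMul` (p694998) and
`FundamentalDomainProduct` (p695471: the domain `e.symm '' (univ ×ˢ S)` as a fundamental domain), none imported here.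

WHAT IS TYPED — the GENERIC core of plan-4's cut C-L4-PRODINT first statement (Factorisation-STATEMENTS-v2 Part 4,
`setIntegral_prodDomain_eq`: «`Measure.map` of a product restricted to `univ ×ˢ DZ_f` is the product of `ν_∞` and
`ν_f.restrict DZ_f`»), for any continuous group isomorphism `e : G ≃ₜ* H₁ × H₂` of topological groups with Borel σ-algebras
(`H₂` second countable), `ν₁`, `ν₂` s-finite, `S` ANY subset of `H₂` (no measurability asked — the restriction
lemmas along a measurable embedding need none):
* **`restrict_smul_map_symm_univ_prod`**: `(c • Measure.map e.symm (ν₁.prod ν₂)).restrict (e.symm '' (univ ×ˢ S)) =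
  c • Measure.map e.symm (ν₁.prod (ν₂.restrict S))` (`Measure.restrict_smul`, `MeasurableEmbedding.restrict_map` along the
  homeomorphism, `Measure.prod_restrict`, `Measure.restrict_univ`);
* **`setIntegral_image_symm_univ_prod`**: for `μ = c • Measure.map e.symm (ν₁.prod ν₂)` and `F` integrable on
  `e.symm '' (univ ×ˢ S)` against `μ`, `∫ x in e.symm '' (univ ×ˢ S), F x ∂μ = (c : ℝ) • ∫ a, ∫ b in S, F (e.symm (a, b)) ∂ν₂ ∂ν₁`
  (no `c ≠ 0` hypothesis: at `c = 0` both sides are `0`).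
At `e := torusSplit W`, `S := DZ_f` the set `e.symm '' (univ ×ˢ S)` is plan-4's `prodDomain W DZf` and the second statement is
`setIntegral_prodDomain_eq` verbatim (with `F (a * b)` for `F (e.symm (a, b))`, `rfl` on the `(a, b) ↦ a * b` inverse).

Nothing here says anything about the status of the Hodge conjecture for CM abelian varieties, which is NOT proved
(HC_CM is NOT proved by anyone in this repository).
-/

set_option autoImplicit false

noncomputable section

open MeasureTheory Measure Set Function
open scoped NNReal ENNReal

namespace Summit.Ventures.HodgeRepro.Tier4.Common

section HaarProductSetIntegral

variable {G H₁ H₂ : Type*}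
  [Group G] [TopologicalSpace G] [MeasurableSpace G] [BorelSpace G]
  [Group H₁] [TopologicalSpace H₁] [MeasurableSpace H₁] [BorelSpace H₁]
  [Group H₂] [TopologicalSpace H₂] [MeasurableSpace H₂] [BorelSpace H₂] [SecondCountableTopology H₂]

/-- **Restriction of `c • (e.symm)_*(ν₁ ⊗ ν₂)` to the product domain `e.symm '' (univ ×ˢ S)`** is
`c • (e.symm)_*(ν₁ ⊗ ν₂.restrict S)`. -/
theorem restrict_smul_map_symm_univ_prod (e : G ≃ₜ* H₁ × H₂)
    (ν₁ : Measure H₁) [SFinite ν₁] (ν₂ : Measure H₂) [SFinite ν₂] (c : ℝ≥0) (S : Set H₂) :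
    (c • Measure.map e.symm (ν₁.prod ν₂)).restrict (e.symm '' ((univ : Set H₁) ×ˢ S)) =
      c • Measure.map e.symm (ν₁.prod (ν₂.restrict S)) := by
  have hmeq : ∀ m : Measure (H₁ × H₂), Measure.map e.symm m =
      Measure.map (e.symm.toHomeomorph.toMeasurableEquiv) m := fun _ => rfl
  have himg : e.symm '' ((univ : Set H₁) ×ˢ S) =
      e.symm.toHomeomorph.toMeasurableEquiv '' ((univ : Set H₁) ×ˢ S) := rfl
  rw [Measure.restrict_smul, hmeq, hmeq, himg,
    (e.symm.toHomeomorph.toMeasurableEquiv).measurableEmbedding.restrict_map,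
    preimage_image_eq _ (e.symm.toHomeomorph.toMeasurableEquiv).injective, ← Measure.prod_restrict,
    Measure.restrict_univ]

/-- **The set integral over the product domain `e.symm '' (univ ×ˢ S)` against `μ = c • (e.symm)_*(ν₁ ⊗ ν₂)` is `c` times
the iterated integral with the inner integral over `S`.**  No hypothesis on `c`: at `c = 0` both sides vanish. -/
theorem setIntegral_image_symm_univ_prod (e : G ≃ₜ* H₁ × H₂) (μ : Measure G)
    (ν₁ : Measure H₁) [SFinite ν₁] (ν₂ : Measure H₂) [SFinite ν₂]
    (c : ℝ≥0) (hc : μ = c • Measure.map e.symm (ν₁.prod ν₂)) (S : Set H₂)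
    (F : G → ℂ) (hF : IntegrableOn F (e.symm '' ((univ : Set H₁) ×ˢ S)) μ) :
    ∫ x in e.symm '' ((univ : Set H₁) ×ˢ S), F x ∂μ =
      (c : ℝ) • ∫ a, ∫ b in S, F (e.symm (a, b)) ∂ν₂ ∂ν₁ := by
  subst hc
  rw [IntegrableOn, restrict_smul_map_symm_univ_prod e ν₁ ν₂ c S] at hF
  rw [restrict_smul_map_symm_univ_prod e ν₁ ν₂ c S]
  rcases eq_or_ne c 0 with rfl | hc0
  · rw [zero_smul, integral_zero_measure, NNReal.coe_zero, zero_smul]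
  · have hmeq : Measure.map e.symm (ν₁.prod (ν₂.restrict S)) =
        Measure.map (e.symm.toHomeomorph.toMeasurableEquiv) (ν₁.prod (ν₂.restrict S)) := rfl
    have hsm : (c • Measure.map e.symm (ν₁.prod (ν₂.restrict S)) : Measure G) =
        ((c : ℝ≥0∞) • Measure.map e.symm (ν₁.prod (ν₂.restrict S))) := Measure.ext fun _ _ => rfl
    have hint : Integrable (fun p : H₁ × H₂ => F (e.symm p)) (ν₁.prod (ν₂.restrict S)) := by
      rw [hsm, integrable_smul_measure (by exact_mod_cast hc0) ENNReal.coe_ne_top, hmeq,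
        integrable_map_equiv] at hF
      exact hF
    rw [integral_smul_nnreal_measure, NNReal.smul_def, hmeq, integral_map_equiv]
    congr 1
    exact integral_prod (fun p : H₁ × H₂ => F (e.symm p)) hint

end HaarProductSetIntegral

end Summit.Ventures.HodgeRepro.Tier4.Common
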